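import Literature.NumberTheory.LFunctions.KMVFirstMomentBeyondDiagonal
import Literature.NumberTheory.LFunctions.Bettin2017CentralValueDampedTwist
import Literature.NumberTheory.LFunctions.Bettin2017HarmonicDampedTwist
import Literature.NumberTheory.LFunctions.Bettin2017DualTail
import Literature.NumberTheory.LFunctions.Bettin2017OffDiagonal
import HarnessLib

/-!
# Bettin 2017, Thm. 1.1 at prime level from Petersson's formula: the twisted harmonic first moment
# `Σ^h_f λ_f(m) L(½,f) = m^{-1/2} + O(m^{1/2} N^{-1+ε})` for `m ≤ N^B` (kernel theorem), and the
# reduction of the named fact `bettin2017_theorem11_primeLevel` to Petersson + the regime `m ≥ N^B`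

Topic `Literature/NumberTheory/LFunctions` (cell landau-siegel / ls-inputs, input I2; the kernel
composition of the skeleton `hecke_afe_petersson` with its elementary stubs S1, S2, S4, S5
discharged by the tree files `Bettin2017CentralValueDampedTwist`, `Bettin2017HarmonicDampedTwist`,
`Bettin2017OffDiagonal`, `Bettin2017DualTail`).

* `Bettin2017.firstMoment_sub_le_of_petersson` — **Bettin 2017, Thm. 1.1 (ν = 1, k = 2, χ trivial,
  α = 0) in the regime `1 ≤ m ≤ N^B`, for every `B`, GIVEN Petersson's formula at prime level**
  (`KowalskiMichel2000.kowalskiMichel2000_peterssonFormula`, Kowalski–Michel 2000 §2.4.2 = Bettin's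
  Lemma 2.2): for every `ε > 0` there are `C, N₀` with
  `‖Σ^h_{f ∈ S_2(N)^*} λ_f(m) L(½,f) − m^{-1/2}‖ ≤ C m^{1/2} N^{-1+ε}` for all primes `N ≥ N₀` and
  `1 ≤ m ≤ N^B`. Proof (Bettin §2 with the exact two-sided central-value formula at the unbalanced
  height `y = 1/(mN²)` in place of Lemma 2.1): `L(½,f) = D_f(y) − ε_f D_f(mN)` inside `Σ^h`
  (`centralValue_eq_dampedTwist_sub`), `Σ^h λ_f(m) D_f(y) = Σ_n w(n) Σ^h λ_f(m)λ_f(n)`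
  (`harmonicSum_heckeLambda_mul_dampedTwist`), Petersson termwise gives
  `w(m) − Σ_n w(n) J_N(m,n)`, `|w(m) − m^{-1/2}| ≤ 2π m^{1/2} N^{-2}`, the off-diagonal is
  `≤ C₄ m^{1/2} N^{-1+ε}` (`offDiagonal_le`) and the dual piece `≤ C₅ m^{1/2} N^{-2}`
  (`dualTail_of_peterssonFormula`). This is everything the consumers of I2 use (`m < N`).
* `Bettin2017.bettin2017_theorem11_primeLevel_of_petersson_of_largeShift` — the named fact AS
  TYPED (all `m ≥ 1`) follows from Petersson's formula and the remaining regime `m ≥ N^B` («we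
  assume m ≪ N^{100}, otherwise the result is trivial», Bettin p. 5 — trivial by the
  Ramanujan–Petersson bound for weight-2 newforms, Deligne 1974 / Eichler–Shimura–Igusa, which the
  tree does not have; hence it stays a hypothesis here).

No definition, no named fact; no claim about Landau–Siegel zeros. «The programme SEARCHES and
TYPES; no claim about Landau–Siegel zeros, Theorems 1–2 of arXiv:2211.02515 or a repaired
Margin232 until a kernel theorem says so.»
-/

noncomputable section

open scoped Real
open Complex CongruenceSubgroup
open Literature.NumberTheory.EllipticCurves.ModularForms

namespace Literature.NumberTheory.LFunctions.Bettin2017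

/-- `1 − e^{−x} ≤ x` for `0 ≤ x`. [folklore] -/
private theorem one_sub_exp_neg_le (x : ℝ) : 1 - Real.exp (-x) ≤ x := by
  have h := Real.add_one_le_exp (-x)
  linarith

/-- The diagonal weight at `n = m`: `|m^{-1/2} e^{-2π m y} − m^{-1/2}| ≤ 2π m^{1/2} y` for `m ≥ 1`,
`y ≥ 0`. [folklore] -/
private theorem norm_diag_sub_le {m : ℕ} (hm : 1 ≤ m) {y : ℝ} (hy : 0 ≤ y) :
    ‖(((m : ℝ) ^ (-(1 / 2 : ℝ)) * Real.exp (-(2 * Real.pi * m) * y) : ℝ) : ℂ) -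
        (((m : ℝ) ^ (-(1 / 2 : ℝ)) : ℝ) : ℂ)‖ ≤
      2 * Real.pi * (m : ℝ) ^ (1 / 2 : ℝ) * y := by
  have hm0 : (0 : ℝ) < m := by exact_mod_cast hm
  have hm1 : (1 : ℝ) ≤ m := by exact_mod_cast hm
  rw [← Complex.ofReal_sub, Complex.norm_real, Real.norm_eq_abs]
  have hx : (0 : ℝ) ≤ 2 * Real.pi * m * y := by positivity
  have he1 : Real.exp (-(2 * Real.pi * m) * y) ≤ 1 := by
    rw [Real.exp_le_one_iff]; linarith
  have he2 : 1 - Real.exp (-(2 * Real.pi * m) * y) ≤ 2 * Real.pi * m * y := by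
    have := one_sub_exp_neg_le (2 * Real.pi * m * y)
    rwa [show -(2 * Real.pi * m * y) = -(2 * Real.pi * m) * y by ring] at this
  have hr0 : 0 ≤ (m : ℝ) ^ (-(1 / 2 : ℝ)) := Real.rpow_nonneg hm0.le _
  rw [show (m : ℝ) ^ (-(1 / 2 : ℝ)) * Real.exp (-(2 * Real.pi * m) * y) - (m : ℝ) ^ (-(1 / 2 : ℝ)) =
      -((m : ℝ) ^ (-(1 / 2 : ℝ)) * (1 - Real.exp (-(2 * Real.pi * m) * y))) by ring,
    abs_neg, abs_of_nonneg (mul_nonneg hr0 (by linarith))]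
  -- `m^{-1/2} · 2π m y = 2π m^{1/2} y`
  have hpow : (m : ℝ) ^ (-(1 / 2 : ℝ)) * m = (m : ℝ) ^ (1 / 2 : ℝ) := by
    rw [show (m : ℝ) ^ (-(1 / 2 : ℝ)) * m = (m : ℝ) ^ (-(1 / 2 : ℝ)) * (m : ℝ) ^ (1 : ℝ) by
        rw [Real.rpow_one], ← Real.rpow_add hm0]
    norm_num
  calc (m : ℝ) ^ (-(1 / 2 : ℝ)) * (1 - Real.exp (-(2 * Real.pi * m) * y))
      ≤ (m : ℝ) ^ (-(1 / 2 : ℝ)) * (2 * Real.pi * m * y) :=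
        mul_le_mul_of_nonneg_left he2 hr0
    _ = 2 * Real.pi * ((m : ℝ) ^ (-(1 / 2 : ℝ)) * m) * y := by ring
    _ = 2 * Real.pi * (m : ℝ) ^ (1 / 2 : ℝ) * y := by rw [hpow]

/-- **Bettin 2017, Thm. 1.1 at prime level (`ν = 1`, `k = 2`, `χ` trivial, `α = 0`) for
`1 ≤ m ≤ N^B`, from Petersson's formula**: for every `B` and `ε > 0` there are `C, N₀` with
`‖Σ^h_{f ∈ S_2(N)^*} λ_f(m) L(½,f) − m^{-1/2}‖ ≤ C m^{1/2} N^{-1+ε}` for all primes `N ≥ N₀` and all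
`1 ≤ m ≤ N^B` (`Σ^h = GL2Family.harmonicSum N 2`, `λ_f = GL2Family.heckeLambda`,
`L(½,f) = IwaniecSarnak.centralValue`). The constant is `2π + |C₄| + |C₅|` with `C₄` from the
off-diagonal bound and `C₅` from the dual piece. [cite: Bettin2017, Thm. 1.1 (case ν = 1, k = 2, χ = 1, α = 0) with §2 (2.1)–(2.5)] -/
theorem firstMoment_sub_le_of_petersson (hP : KowalskiMichel2000.kowalskiMichel2000_peterssonFormula) :
    ∀ B : ℕ, ∀ ε : ℝ, 0 < ε → ∃ C : ℝ, ∃ N₀ : ℕ, ∀ (N : ℕ) [NeZero N], N.Prime → N₀ ≤ N →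
      ∀ m : ℕ, 1 ≤ m → (m : ℝ) ≤ (N : ℝ) ^ B →
        ‖GL2Family.harmonicSum N 2
              (fun f ↦ GL2Family.heckeLambda f m * IwaniecSarnak.centralValue f) -
            (((m : ℝ) ^ (-(1 / 2 : ℝ)) : ℝ) : ℂ)‖ ≤
          C * (m : ℝ) ^ (1 / 2 : ℝ) * (N : ℝ) ^ (-1 + ε) := by
  intro B ε hε
  obtain ⟨C₄, N₄, H₄⟩ := offDiagonal_le B ε hε
  obtain ⟨C₅, N₅, H₅⟩ := dualTail_of_peterssonFormula hP
  refine ⟨2 * Real.pi + |C₄| + |C₅|, max (max N₄ N₅) 2, fun N _ hN hN₀ m hm hmB ↦ ?_⟩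
  have hN₄ : N₄ ≤ N := le_trans (le_trans (le_max_left _ _) (le_max_left _ _)) hN₀
  have hN₅ : N₅ ≤ N := le_trans (le_trans (le_max_right _ _) (le_max_left _ _)) hN₀
  have hN2 : 2 ≤ N := le_trans (le_max_right _ _) hN₀
  have hNR1 : (1 : ℝ) ≤ N := by exact_mod_cast le_trans (by norm_num) hN2
  have hNR0 : (0 : ℝ) < N := by linarith
  have hm0 : (0 : ℝ) < m := by exact_mod_cast hm
  -- the common size `X = m^{1/2} N^{-1+ε} ≥ 0`, and `N^{-2} ≤ N^{-1+ε}`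
  set X : ℝ := (m : ℝ) ^ (1 / 2 : ℝ) * (N : ℝ) ^ (-1 + ε) with hX_def
  have hX0 : 0 ≤ X := mul_nonneg (Real.rpow_nonneg hm0.le _) (Real.rpow_nonneg hNR0.le _)
  have hN2ε : (N : ℝ) ^ (-(2 : ℝ)) ≤ (N : ℝ) ^ (-1 + ε) :=
    Real.rpow_le_rpow_of_exponent_le hNR1 (by linarith)
  set y : ℝ := 1 / ((m : ℝ) * (N : ℝ) ^ 2) with hy_def
  have hy : 0 < y := by rw [hy_def]; positivity
  have hyN : 1 / ((N : ℝ) * y) = (m : ℝ) * N := by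
    rw [hy_def]; field_simp
  -- the weight `w(n) = n^{-1/2} e^{-2π n y}`
  set w : ℕ → ℂ := fun n ↦
    (((n : ℝ) ^ (-(1 / 2 : ℝ)) * Real.exp (-(2 * Real.pi * n) * y) : ℝ) : ℂ) with hw_def
  have hw0 : w 0 = 0 := by
    simp only [hw_def, Nat.cast_zero]
    rw [Real.zero_rpow (by norm_num : (-(1 / 2 : ℝ)) ≠ 0), zero_mul, Complex.ofReal_zero]
  -- Step 1: the exact AFE inside the harmonic sum
  have hfin := finite_newforms0_holds N 2
  have step1 : GL2Family.harmonicSum N 2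
        (fun f ↦ GL2Family.heckeLambda f m * IwaniecSarnak.centralValue f) =
      GL2Family.harmonicSum N 2
          (fun f ↦ GL2Family.heckeLambda f m * dampedTwist f (fun _ ↦ 1) y) -
        GL2Family.harmonicSum N 2
          (fun f ↦ frickeEigenvalue f * GL2Family.heckeLambda f m *
            dampedTwist f (fun _ ↦ 1) ((m : ℝ) * N)) := by
    unfold GL2Family.harmonicSum
    rw [← finsum_mem_sub_distrib _ _ hfin]
    refine finsum_mem_congr rfl fun f hf ↦ ?_
    beta_reduce
    rw [centralValue_eq_dampedTwist_sub_all N f hf y hy, hyN]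
    ring
  -- Step 2: through the `n`-series
  obtain ⟨hsumP, step2⟩ := harmonicSum_heckeLambda_mul_dampedTwist_all N m y hy
  -- Step 3: Petersson, `pet = δ − petJ` termwise against the weight
  set P : ℕ → ℂ := fun n ↦ w n * KowalskiMichel2000.pet N m n with hP_def
  set Q : ℕ → ℂ := fun n ↦ w n * KowalskiMichel2000.petJ N m n with hQ_def
  set D : ℕ → ℂ := fun n ↦ if n = m then w m else 0 with hD_def
  have hPDQ : ∀ n, P n = D n - Q n := by
    intro n
    rcases Nat.eq_zero_or_pos n with rfl | hn
    · simp only [hP_def, hQ_def, hD_def, hw0, zero_mul]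
      have : (0 : ℕ) ≠ m := by omega
      rw [if_neg this, sub_zero]
    · have hpet := (hP N hN m n hm hn).2
      simp only [hP_def, hQ_def, hD_def]
      rw [hpet, mul_sub]
      congr 1
      by_cases hnm : n = m
      · subst hnm; simp
      · rw [if_neg hnm, if_neg (Ne.symm hnm), mul_zero]
  have hDsum : HasSum D (w m) := by
    simpa [hD_def] using hasSum_ite_eq m (w m)
  have hPsum : Summable P := Summable.of_norm hsumP
  have hQsum : Summable Q := by
    have : Q = fun n ↦ D n - P n := by funext n; rw [hPDQ]; ring
    rw [this]
    exact hDsum.summable.sub hPsum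
  have step3 : ∑' n : ℕ, P n = w m - ∑' n : ℕ, Q n := by
    rw [tsum_congr hPDQ, hDsum.summable.tsum_sub hQsum, hDsum.tsum_eq]
  -- the three estimates
  have hE4 : ‖∑' n : ℕ, Q n‖ ≤ |C₄| * X := by
    have h := H₄ N hN hN₄ m hm hmB
    refine h.trans ?_
    rw [hX_def, ← mul_assoc]
    exact mul_le_mul_of_nonneg_right (mul_le_mul_of_nonneg_right (le_abs_self _)
      (Real.rpow_nonneg hm0.le _)) (Real.rpow_nonneg hNR0.le _)
  have hE5 : ‖GL2Family.harmonicSum N 2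
      (fun f ↦ frickeEigenvalue f * GL2Family.heckeLambda f m *
        dampedTwist f (fun _ ↦ 1) ((m : ℝ) * N))‖ ≤ |C₅| * X := by
    have h := H₅ N hN hN₅ m hm
    refine h.trans ?_
    calc C₅ * (m : ℝ) ^ (1 / 2 : ℝ) * (N : ℝ) ^ (-(2 : ℝ))
        ≤ |C₅| * (m : ℝ) ^ (1 / 2 : ℝ) * (N : ℝ) ^ (-(2 : ℝ)) :=
          mul_le_mul_of_nonneg_right (mul_le_mul_of_nonneg_right (le_abs_self _)
            (Real.rpow_nonneg hm0.le _)) (Real.rpow_nonneg hNR0.le _)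
      _ ≤ |C₅| * (m : ℝ) ^ (1 / 2 : ℝ) * (N : ℝ) ^ (-1 + ε) :=
          mul_le_mul_of_nonneg_left hN2ε (mul_nonneg (abs_nonneg _) (Real.rpow_nonneg hm0.le _))
      _ = |C₅| * X := by rw [hX_def]; ring
  have hEd : ‖w m - (((m : ℝ) ^ (-(1 / 2 : ℝ)) : ℝ) : ℂ)‖ ≤ 2 * Real.pi * X := by
    have h := norm_diag_sub_le hm hy.le
    refine h.trans ?_
    -- `2π m^{1/2} y = 2π m^{-1/2} N^{-2} ≤ 2π m^{1/2} N^{-2} ≤ 2π X`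
    have hy_le : y ≤ (N : ℝ) ^ (-(2 : ℝ)) := by
      rw [hy_def, Real.rpow_neg hNR0.le, show ((2 : ℝ)) = ((2 : ℕ) : ℝ) by norm_num,
        Real.rpow_natCast, one_div]
      have hm1 : (1 : ℝ) ≤ m := by exact_mod_cast hm
      have hN2pos : (0 : ℝ) < (N : ℝ) ^ 2 := by positivity
      rw [inv_le_inv₀ (by positivity) hN2pos]
      nlinarith
    calc 2 * Real.pi * (m : ℝ) ^ (1 / 2 : ℝ) * y
        ≤ 2 * Real.pi * (m : ℝ) ^ (1 / 2 : ℝ) * (N : ℝ) ^ (-(2 : ℝ)) := by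
          gcongr
      _ ≤ 2 * Real.pi * (m : ℝ) ^ (1 / 2 : ℝ) * (N : ℝ) ^ (-1 + ε) := by
          gcongr
      _ = 2 * Real.pi * X := by rw [hX_def]; ring
  -- assemble
  rw [step1, step2]
  change ‖∑' n : ℕ, P n - _ - _‖ ≤ _
  rw [step3]
  set Dual := GL2Family.harmonicSum N 2
      (fun f ↦ frickeEigenvalue f * GL2Family.heckeLambda f m *
        dampedTwist f (fun _ ↦ 1) ((m : ℝ) * N)) with hDual
  calc ‖w m - ∑' n : ℕ, Q n - Dual - (((m : ℝ) ^ (-(1 / 2 : ℝ)) : ℝ) : ℂ)‖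
      = ‖(w m - (((m : ℝ) ^ (-(1 / 2 : ℝ)) : ℝ) : ℂ)) - ∑' n : ℕ, Q n - Dual‖ := by ring_nf
    _ ≤ ‖w m - (((m : ℝ) ^ (-(1 / 2 : ℝ)) : ℝ) : ℂ)‖ + ‖∑' n : ℕ, Q n‖ + ‖Dual‖ := by
        refine (norm_sub_le _ _).trans ?_
        gcongr
        exact norm_sub_le _ _
    _ ≤ 2 * Real.pi * X + |C₄| * X + |C₅| * X := by gcongr
    _ = (2 * Real.pi + |C₄| + |C₅|) * X := by ring
    _ = _ := by rw [hX_def]; ring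


/-- **The named fact from Petersson's formula and the large-shift regime.** Bettin 2017, Thm. 1.1
at prime level AS TYPED (`bettin2017_theorem11_primeLevel`: all `m ≥ 1`) follows from
Petersson's formula at prime level (input I1) and the statement in the regime `m ≥ N^B` for some
`B` (Bettin p. 5: «we assume m ≪ N^{100}, otherwise the result is trivial» — by the
Ramanujan–Petersson bound for weight-2 newforms, not available in the tree).
[cite: Bettin2017, Thm. 1.1 and §2 (p. 5, first paragraph)] -/
theorem bettin2017_theorem11_primeLevel_of_petersson_of_largeShift
    (hP : KowalskiMichel2000.kowalskiMichel2000_peterssonFormula)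
    (hL : ∃ B : ℕ, ∀ ε : ℝ, 0 < ε → ∃ C : ℝ, ∃ N₀ : ℕ, ∀ (N : ℕ) [NeZero N], N.Prime → N₀ ≤ N →
      ∀ m : ℕ, (N : ℝ) ^ B ≤ m →
        ‖GL2Family.harmonicSum N 2
              (fun f ↦ GL2Family.heckeLambda f m * IwaniecSarnak.centralValue f) -
            (((m : ℝ) ^ (-(1 / 2 : ℝ)) : ℝ) : ℂ)‖ ≤
          C * (m : ℝ) ^ (1 / 2 : ℝ) * (N : ℝ) ^ (-1 + ε)) :
    bettin2017_theorem11_primeLevel := by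
  intro ε hε
  obtain ⟨B, hB⟩ := hL
  obtain ⟨C₆, N₆, H₆⟩ := hB ε hε
  obtain ⟨C₁, N₁, H₁⟩ := firstMoment_sub_le_of_petersson hP B ε hε
  refine ⟨max C₆ C₁, max N₆ N₁, fun N _ hN hN₀ m hm ↦ ?_⟩
  have hN₆ : N₆ ≤ N := le_trans (le_max_left _ _) hN₀
  have hN₁ : N₁ ≤ N := le_trans (le_max_right _ _) hN₀
  have hNR0 : (0 : ℝ) < N := by exact_mod_cast hN.pos
  have hm0 : (0 : ℝ) < m := by exact_mod_cast hm
  have hX0 : 0 ≤ (m : ℝ) ^ (1 / 2 : ℝ) * (N : ℝ) ^ (-1 + ε) :=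
    mul_nonneg (Real.rpow_nonneg hm0.le _) (Real.rpow_nonneg hNR0.le _)
  by_cases hcase : (N : ℝ) ^ B ≤ m
  · calc _ ≤ C₆ * (m : ℝ) ^ (1 / 2 : ℝ) * (N : ℝ) ^ (-1 + ε) := H₆ N hN hN₆ m hcase
      _ = C₆ * ((m : ℝ) ^ (1 / 2 : ℝ) * (N : ℝ) ^ (-1 + ε)) := by ring
      _ ≤ max C₆ C₁ * ((m : ℝ) ^ (1 / 2 : ℝ) * (N : ℝ) ^ (-1 + ε)) :=
          mul_le_mul_of_nonneg_right (le_max_left _ _) hX0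
      _ = _ := by ring
  · calc _ ≤ C₁ * (m : ℝ) ^ (1 / 2 : ℝ) * (N : ℝ) ^ (-1 + ε) :=
          H₁ N hN hN₁ m hm (not_le.mp hcase).le
      _ = C₁ * ((m : ℝ) ^ (1 / 2 : ℝ) * (N : ℝ) ^ (-1 + ε)) := by ring
      _ ≤ max C₆ C₁ * ((m : ℝ) ^ (1 / 2 : ℝ) * (N : ℝ) ^ (-1 + ε)) :=
          mul_le_mul_of_nonneg_right (le_max_right _ _) hX0
      _ = _ := by ring

end Literature.NumberTheory.LFunctions.Bettin2017

end
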